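import Summits.AtomisticToContinuum.HydrodynamicLimit.Theorems.VitaliAmplitudeTransferAmplitudeTransferIdentification

/-!
# Amplitude transfer — scalar observables of the hydrodynamic fields (steps (3) and (5))

Bookkeeping between `TendstoHydroFieldsAt` (convergence in probability of the density, momentum
and energy fields tested against `χ`) and the five scalar one-body empirical observables
`∫ w dμ_{Φ_t z}` with `w = χ`, `χ v_l` (`l = 1,2,3`), `χ |v|²/2`, as used by the Vitali amplitude
transfer (route `VitaliAmplitudeTransfer`, item `AmplitudeTransfer`):

* `tendsto_mean_of_prob_of_evariance` — convergence in probability plus a CLT-size variance bound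
  `(N+1) eVar ≤ C` gives convergence of the means (step (3));
* `prob_scalars_of_tendstoHydroFieldsAt` / `tendstoHydroFieldsAt_of_prob_scalars` — the field
  convergence is equivalent to the convergence in probability of the five scalar observables
  (momentum coordinatewise; step (5)).
-/

noncomputable section

open MeasureTheory ProbabilityTheory Filter Set Topology
open scoped ENNReal

namespace Summit.AtomisticToContinuum.HydrodynamicLimit.Theorems.AmplitudeTransfer

open Literature.MathematicalPhysics.KineticTheory Literature.Analysis.FluidPDE

/-- **Means converge** when the variables converge in probability and `(N+1)·eVar ≤ C`. -/
theorem tendsto_mean_of_prob_of_evariance {Ω : ℕ → Type*} [∀ N, MeasurableSpace (Ω N)]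
    {P : (N : ℕ) → Measure (Ω N)} [∀ N, IsProbabilityMeasure (P N)]
    {X : (N : ℕ) → Ω N → ℝ} {c C : ℝ} (hXm : ∀ N, AEStronglyMeasurable (X N) (P N))
    (hvar : ∀ N : ℕ, ((N : ℝ≥0∞) + 1) * evariance (X N) (P N) ≤ ENNReal.ofReal C)
    (hprob : ∀ ε > (0 : ℝ), Tendsto (fun N => P N {ω | ε < |X N ω - c|}) atTop (𝓝 0)) :
    Tendsto (fun N => ∫ ω, X N ω ∂P N) atTop (𝓝 c) := by
  have hC0 : 0 ≤ max C 0 := le_max_right _ _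
  have hvar' : ∀ N : ℕ, ((N : ℝ≥0∞) + 1) * evariance (X N) (P N) ≤ ENNReal.ofReal (max C 0) :=
    fun N => (hvar N).trans (ENNReal.ofReal_le_ofReal (le_max_left _ _))
  have h := fun N => memLp_two_and_variance_le_of_evariance_le (hXm N) hC0 N (hvar' N)
  refine tendsto_integral_of_tendsto_measure (fun N => (h N).1) ?_ hprob
  have hrate : Tendsto (fun N : ℕ => max C 0 / ((N : ℝ) + 1)) atTop (𝓝 0) := by
    have h1 : Tendsto (fun N : ℕ => max C 0 * (1 / ((N : ℝ) + 1))) atTop (𝓝 (max C 0 * 0)) :=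
      tendsto_one_div_add_atTop_nhds_zero_nat.const_mul _
    rw [mul_zero] at h1
    exact h1.congr fun N => by ring
  exact tendsto_of_tendsto_of_tendsto_of_le_of_le tendsto_const_nhds hrate
    (fun N => variance_nonneg _ _) (fun N => (h N).2)

/-- A coordinate of the empirical momentum field is the empirical observable `χ(x) v_l`. -/
theorem empiricalMomentumField_apply {N : ℕ} (z : Config N (Fin 3) T3) (χ : T3 → ℝ) (l : Fin 3) :
    empiricalMomentumField z χ l = ∫ y, χ y.1 * y.2 l ∂(empiricalMeasure z) := by
  rw [empiricalMomentumField_eq_sum, integral_empiricalMeasure]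
  simp only [PiLp.smul_apply, WithLp.ofLp_sum, Finset.sum_apply, smul_eq_mul, WithLp.ofLp_smul,
    Pi.smul_apply]

/-- A coordinate of the tested Euler momentum `∫ χρu` is `∫ χ ρ u_l` (continuous fields). -/
theorem integral_smul_apply {ρ₀ χ : T3 → ℝ} {u₀ : T3 → V3} (hχ : Continuous χ) (hρ : Continuous ρ₀)
    (hu : Continuous u₀) (l : Fin 3) :
    (∫ x, (χ x * ρ₀ x) • u₀ x) l = ∫ x, χ x * ρ₀ x * u₀ x l := by
  have hi : Integrable fun x => (χ x * ρ₀ x) • u₀ x := integrable_of_continuous_T3 ((hχ.mul hρ).smul hu)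
  rw [integral_apply_V3 hi l]
  simp only [PiLp.smul_apply, smul_eq_mul]

/-- **From the fields to the five scalars.** `TendstoHydroFieldsAt` gives convergence in
probability of the density observable `χ`, the momentum observables `χ v_l` and the energy
observable `χ |v|²/2` towards the corresponding tested Euler fields. -/
theorem prob_scalars_of_tendstoHydroFieldsAt {ε : ℕ → ℝ}
    {P : (N : ℕ) → Measure (Config (N + 1) (Fin 3) T3)}
    {Φ : (N : ℕ) → HardSphereFlow (Torus.geometry (Fin 3)) (ε N) (N + 1)}
    {ρ θ : ℝ → T3 → ℝ} {u : ℝ → T3 → V3} {t : ℝ} (h : TendstoHydroFieldsAt P Φ ρ u θ t)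
    (hρ : Continuous (ρ t)) (hu : Continuous (u t)) {χ : T3 → ℝ} (hχ : Continuous χ) {η : ℝ}
    (hη : 0 < η) :
    Tendsto (fun N => P N {z | η < |(∫ y, χ y.1 ∂(empiricalMeasure ((Φ N).flow t z))) -
      ∫ x, χ x * ρ t x|}) atTop (𝓝 0) ∧
    (∀ l : Fin 3, Tendsto (fun N => P N {z | η < |(∫ y, χ y.1 * y.2 l ∂(empiricalMeasure ((Φ N).flow t z))) -
      ∫ x, χ x * ρ t x * u t x l|}) atTop (𝓝 0)) ∧
    Tendsto (fun N => P N {z | η < |(∫ y, χ y.1 * (‖y.2‖ ^ 2 / 2) ∂(empiricalMeasure ((Φ N).flow t z))) -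
      ∫ x, χ x * totalEnergyDensity (ρ t x) (u t x) (θ t x)|}) atTop (𝓝 0) := by
  obtain ⟨hd, hm, he⟩ := h χ hχ η hη
  refine ⟨hd, fun l => ?_, he⟩
  refine tendsto_of_tendsto_of_tendsto_of_le_of_le tendsto_const_nhds hm (fun N => zero_le)
    (fun N => ?_)
  refine measure_mono fun z hz => ?_
  simp only [mem_setOf_eq] at hz ⊢
  refine lt_of_lt_of_le hz ?_
  rw [← empiricalMomentumField_apply, ← integral_smul_apply hχ hρ hu l]
  have := PiLp.norm_apply_le (empiricalMomentumField ((Φ N).flow t z) χ - ∫ x, (χ x * ρ t x) • u t x) l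
  simpa [Real.norm_eq_abs] using this

/-- **From the five scalars to the fields.** Convergence in probability of the density, momentum
coordinate and energy observables gives `TendstoHydroFieldsAt` (union bound over the three
coordinates for the momentum field). -/
theorem tendstoHydroFieldsAt_of_prob_scalars {ε : ℕ → ℝ}
    {P : (N : ℕ) → Measure (Config (N + 1) (Fin 3) T3)}
    {Φ : (N : ℕ) → HardSphereFlow (Torus.geometry (Fin 3)) (ε N) (N + 1)}
    {ρ θ : ℝ → T3 → ℝ} {u : ℝ → T3 → V3} {t : ℝ} (hρ : Continuous (ρ t)) (hu : Continuous (u t))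
    (hd : ∀ χ : T3 → ℝ, Continuous χ → ∀ η > (0 : ℝ),
      Tendsto (fun N => P N {z | η < |(∫ y, χ y.1 ∂(empiricalMeasure ((Φ N).flow t z))) -
        ∫ x, χ x * ρ t x|}) atTop (𝓝 0))
    (hm : ∀ χ : T3 → ℝ, Continuous χ → ∀ l : Fin 3, ∀ η > (0 : ℝ),
      Tendsto (fun N => P N {z | η < |(∫ y, χ y.1 * y.2 l ∂(empiricalMeasure ((Φ N).flow t z))) -
        ∫ x, χ x * ρ t x * u t x l|}) atTop (𝓝 0))
    (he : ∀ χ : T3 → ℝ, Continuous χ → ∀ η > (0 : ℝ),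
      Tendsto (fun N => P N {z | η < |(∫ y, χ y.1 * (‖y.2‖ ^ 2 / 2) ∂(empiricalMeasure ((Φ N).flow t z))) -
        ∫ x, χ x * totalEnergyDensity (ρ t x) (u t x) (θ t x)|}) atTop (𝓝 0)) :
    TendstoHydroFieldsAt P Φ ρ u θ t := by
  intro χ hχ η hη
  refine ⟨hd χ hχ η hη, ?_, he χ hχ η hη⟩
  have hsum : Tendsto (fun N => ∑ l : Fin 3, P N {z | η / 3 <
      |(∫ y, χ y.1 * y.2 l ∂(empiricalMeasure ((Φ N).flow t z))) - ∫ x, χ x * ρ t x * u t x l|})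
      atTop (𝓝 0) := by
    have := tendsto_finsetSum (Finset.univ : Finset (Fin 3))
      (fun l _ => hm χ hχ l (η / 3) (by positivity))
    simpa using this
  refine tendsto_of_tendsto_of_tendsto_of_le_of_le tendsto_const_nhds hsum (fun N => zero_le)
    (fun N => ?_)
  refine (measure_setOf_lt_norm_le (P N) _ hη.le).trans (le_of_eq ?_)
  refine Finset.sum_congr rfl fun l _ => ?_
  congr 1
  ext z
  simp only [mem_setOf_eq]
  rw [PiLp.sub_apply, empiricalMomentumField_apply, integral_smul_apply hχ hρ hu l]

end Summit.AtomisticToContinuum.HydrodynamicLimit.Theorems.AmplitudeTransfer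

end
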